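import Literature.NumberTheory.Automorphic.GLnParabolicIntermediateHaar
import Literature.NumberTheory.Automorphic.GLnTwoBlockBoxAdLIntegral
import Literature.NumberTheory.Automorphic.LocalFieldHaarBalls
import HarnessLib

/-!
# Refinement of block labellings (`U_{f∘c} ≤ U_c ≤ P_c ≤ P_{f∘c}`) and the triviality of the module
# `‖det K_p‖_F` of `Ad(p)` on a two-block unipotent radical for unipotent `p`

Topic `NumberTheory/Automorphic`; namespace `Literature.NumberTheory.Automorphic`. KERNEL
mathematics only: theorems, no definition, no named fact, no instance, no `sorry`. Two bookkeeping
facts for the descent of orbital integrals to a split torus through a chain of standard parabolics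
(Rogawski 1990, §4.13; Bernstein–Zelevinsky 1977, §2.1):

* §1 `unipotentRadicalGL_comp_le`, `standardParabolicGL_le_comp` — for a labelling `c : n → α` and a
  MONOTONE coarsening `f : α → β`: **`U_{f ∘ c} ≤ U_c`** and **`P_c ≤ P_{f ∘ c}`** (so
  `U_{f∘c} ≤ U_c ≤ P_c ≤ P_{f∘c}`; e.g. `c = id`, `f` a two-block labelling: the full upper unitriangular
  group `N` sits between the unipotent radical and the parabolic of every standard two-block `P`).
* §2 `normAbs_det_boxAd_eq_one_of_mem_unipotentRadicalGL` — for a two-block `P_c` (`c = f ∘ c'`) and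
  `p ∈ P_c` lying in the unipotent radical `U_{c'}(F)` of a finer standard parabolic:
  **`‖det K_p‖_F = 1`** (`K_p` the matrix of `Ad(p)` on the box): `u ↦ ‖det K_u‖_F` is a continuous
  homomorphism (`boxAd_mul`) on `U_{c'}(F)`, which is a union of compact subgroups
  (`isLimitOfCompactOpen_unipotentRadicalGL`), and `ℝ_{>0}` has no non-trivial compact subgroups;
  `exists_homeomorph_conj_map_eq_of_mem_unipotentRadicalGL`, `lintegral_conj_eq_of_mem_unipotentRadicalGL`
  — hence **conjugation by such `p` preserves every Haar measure of `U_c(F)`**: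
  `∫⁻_{U_c} G(p u p⁻¹) dμ_U = ∫⁻_{U_c} G(u) dμ_U` for every `G`.

## References

* [BernsteinZelevinsky1977] I. N. Bernstein, A. V. Zelevinsky, Ann. Sci. ÉNS 10 (1977), §1.9, §2.1.
* [Rogawski1990] J. D. Rogawski, *Automorphic Representations of Unitary Groups in Three Variables*
  (1990), §4.13.
-/

noncomputable section

open scoped MatrixGroups NNReal ENNReal
open MeasureTheory Measure Matrix Topology

namespace Literature.NumberTheory.Automorphic

open Literature.NumberTheory.GaloisRepresentations.IsNonarchimedeanLocalField

/-! ### 1. Coarser and finer block labellings -/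

section Refinement

variable {R : Type*} [CommRing R] {n : Type*} [Fintype n] [DecidableEq n] {α β : Type*}
  [LinearOrder α] [LinearOrder β] (c : n → α) {f : α → β}

/-- **`U_{f ∘ c} ≤ U_c`** for a monotone coarsening `f` of the block labelling: the unipotent radical of
the coarser parabolic is contained in that of the finer one. [cite: BernsteinZelevinsky1977, §2.1] -/
theorem unipotentRadicalGL_comp_le (hf : Monotone f) :
    unipotentRadicalGL R (f ∘ c) ≤ unipotentRadicalGL R c := by
  intro u hu
  rw [mem_unipotentRadicalGL_iff_entry] at hu ⊢
  obtain ⟨hbt, hdiag⟩ := hu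
  refine ⟨fun i j hij => ?_, fun i j hij => hdiag i j (congrArg f hij)⟩
  rcases (hf hij.le).lt_or_eq with hlt | heq
  · exact hbt hlt
  · rw [hdiag i j heq.symm, Matrix.one_apply, if_neg (fun h => hij.ne' (congrArg c h))]

/-- **`P_c ≤ P_{f ∘ c}`** for a monotone coarsening `f`: the finer parabolic is contained in the
coarser one. [cite: BernsteinZelevinsky1977, §2.1] -/
theorem standardParabolicGL_le_comp (hf : Monotone f) :
    standardParabolicGL R c ≤ standardParabolicGL R (f ∘ c) := by
  intro p hp
  rw [mem_standardParabolicGL_iff] at hp ⊢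
  exact fun i j hij => hp (hf.reflect_lt hij)

/-- `U_c ≤ P_{f ∘ c}` (monotone `f`). [cite: BernsteinZelevinsky1977, §2.1] -/
theorem unipotentRadicalGL_le_standardParabolicGL_comp (hf : Monotone f) :
    unipotentRadicalGL R c ≤ standardParabolicGL R (f ∘ c) :=
  (unipotentRadicalGL_le R c).trans (standardParabolicGL_le_comp c hf)

end Refinement

/-! ### 2. `‖det K_p‖ = 1` for unipotent `p`, and conjugation-invariance of `μ_U` -/

section UnipotentModule

variable {F : Type*} [Field F] [ValuativeRel F] [TopologicalSpace F] [IsNonarchimedeanLocalField F]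
  {n : ℕ} {c : Fin n → Bool} {α : Type*} [LinearOrder α] {c' : Fin n → α}

/-- A compact subset of `ℝ≥0` closed under powers of an element `x > 1` is impossible: if `x ^ k ∈ S`
for all `k` and `S` is bounded above then `x ≤ 1`. [folklore] -/
private theorem le_one_of_pow_mem_bddAbove {S : Set ℝ≥0} (hS : BddAbove S) {x : ℝ≥0}
    (hx : ∀ k : ℕ, x ^ k ∈ S) : x ≤ 1 := by
  by_contra h
  rw [not_le] at h
  obtain ⟨B, hB⟩ := hS
  have htend := tendsto_pow_atTop_atTop_of_one_lt h
  obtain ⟨k, hk⟩ := (Filter.tendsto_atTop.1 htend (B + 1)).exists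
  have := hB (hx k)
  exact absurd (lt_of_lt_of_le (lt_add_one B) hk) (not_lt.2 this)

/-- **`‖det K_p‖_F = 1` when `p` is unipotent**: for a two-block labelling `c = f ∘ c'` (`f`, `c'`
monotone) and `p ∈ P_c(F)` lying in the unipotent radical `U_{c'}(F)` of the finer parabolic, the
module of `Ad(p)` on the box is trivial — `u ↦ ‖det K_u‖_F` is a continuous homomorphism on
`U_{c'}(F)` (`boxAd_mul`), `p` lies in a compact subgroup (`isLimitOfCompactOpen_unipotentRadicalGL`),
and a compact subgroup of `ℝ_{>0}` is trivial. [cite: BernsteinZelevinsky1977, §1.9] -/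
theorem normAbs_det_boxAd_eq_one_of_mem_unipotentRadicalGL (hc' : Monotone c') {f : α → Bool}
    (hf : Monotone f) (hcf : c = f ∘ c') (p : standardParabolicGL F c)
    (hp : (p : GL (Fin n) F) ∈ unipotentRadicalGL F c') :
    normAbs F (Matrix.of fun q q' : {i : Fin n // c i = false} × {j : Fin n // c j = true} =>
        ((p : GL (Fin n) F) : Matrix (Fin n) (Fin n) F) q.1 q'.1 *
          (((p⁻¹ : standardParabolicGL F c) : GL (Fin n) F) : Matrix (Fin n) (Fin n) F) q'.2 q.2).det
      = 1 := by
  classical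
  haveI : T2Space F := (isLocalField F).toT2Space
  have hT : IsTopologicalRing F := inferInstance
  have hUP : unipotentRadicalGL F c' ≤ standardParabolicGL F c := by
    rw [hcf]; exact unipotentRadicalGL_le_standardParabolicGL_comp c' hf
  -- the character `χ(u) = ‖det K_u‖` on `U_{c'}`
  let ι : ↥(unipotentRadicalGL F c') → standardParabolicGL F c := fun u => ⟨u.1, hUP u.2⟩
  let χ : ↥(unipotentRadicalGL F c') → ℝ≥0 := fun u => normAbs F
    (Matrix.of fun q q' : {i : Fin n // c i = false} × {j : Fin n // c j = true} =>
      ((ι u : GL (Fin n) F) : Matrix (Fin n) (Fin n) F) q.1 q'.1 *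
        ((((ι u)⁻¹ : standardParabolicGL F c) : GL (Fin n) F) : Matrix (Fin n) (Fin n) F) q'.2 q.2).det
  have hχmul : ∀ u v, χ (u * v) = χ u * χ v := by
    intro u v
    have hι : ι (u * v) = ι u * ι v := rfl
    simp only [χ, hι, boxAd_mul, Matrix.det_mul, map_mul]
  have hχone : χ 1 = 1 := by
    have hι : ι 1 = 1 := rfl
    simp only [χ, hι, boxAd_one, Matrix.det_one, map_one]
  have hχpow : ∀ u (k : ℕ), χ (u ^ k) = χ u ^ k := by
    intro u k
    induction k with
    | zero => simp [hχone]
    | succ k ih => rw [pow_succ, hχmul, ih, pow_succ]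
  have hχinv : ∀ u, χ u * χ u⁻¹ = 1 := fun u => by rw [← hχmul, mul_inv_cancel, hχone]
  have hχc : Continuous χ := by
    have h1 : Continuous fun u : ↥(unipotentRadicalGL F c') =>
        ((u : GL (Fin n) F) : Matrix (Fin n) (Fin n) F) :=
      Units.continuous_val.comp continuous_subtype_val
    have h2 : Continuous fun u : ↥(unipotentRadicalGL F c') =>
        (((u : GL (Fin n) F)⁻¹ : GL (Fin n) F) : Matrix (Fin n) (Fin n) F) :=
      Units.continuous_coe_inv.comp continuous_subtype_val
    refine (LocalFieldHaar.continuous_normAbs (F := F)).comp ?_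
    refine Continuous.matrix_det ?_
    refine continuous_matrix fun q q' => ?_
    exact (h1.matrix_elem q.1 q'.1).mul (h2.matrix_elem q'.2 q.2)
  -- `p` lies in a compact subgroup `K` of `U_{c'}`; `χ(K)` is bounded and power-closed
  obtain ⟨K, -, hKc, hpK⟩ :=
    isLimitOfCompactOpen_unipotentRadicalGL F c' hc' {⟨(p : GL (Fin n) F), hp⟩} isCompact_singleton
  have hpK' : (⟨(p : GL (Fin n) F), hp⟩ : ↥(unipotentRadicalGL F c')) ∈ K := hpK rfl
  have hbdd : BddAbove (χ '' (K : Set ↥(unipotentRadicalGL F c'))) := (hKc.image hχc).bddAbove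
  have hle : ∀ u ∈ K, χ u ≤ 1 := fun u hu =>
    le_one_of_pow_mem_bddAbove hbdd fun k => ⟨u ^ k, K.pow_mem hu k, hχpow u k⟩
  have hge : 1 ≤ χ ⟨(p : GL (Fin n) F), hp⟩ := by
    have h1 := hle _ (K.inv_mem hpK')
    have h2 := hχinv ⟨(p : GL (Fin n) F), hp⟩
    calc (1 : ℝ≥0) = χ ⟨(p : GL (Fin n) F), hp⟩ * χ (⟨(p : GL (Fin n) F), hp⟩)⁻¹ := h2.symm
      _ ≤ χ ⟨(p : GL (Fin n) F), hp⟩ := mul_le_of_le_one_right (by positivity) h1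
  have hχp : χ ⟨(p : GL (Fin n) F), hp⟩ = 1 := le_antisymm (hle _ hpK') hge
  have hιp : ι ⟨(p : GL (Fin n) F), hp⟩ = p := Subtype.ext rfl
  simpa only [χ, hιp] using hχp

variable [MeasurableSpace F] [BorelSpace F]

/-- **Conjugation by a unipotent element preserves the Haar measures of `U_c(F)`**: for `p ∈ P_c(F)`
in the unipotent radical `U_{c'}(F)` of a finer standard parabolic (`c = f ∘ c'` two-block) there is
a homeomorphism `T` of `U_c(F)` with `T(u) = p u p⁻¹` and `T_* μ_U = μ_U` for every Haar measure
`μ_U` (`exists_homeomorph_unipotentRadicalGL_parabolic_conj` with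
`normAbs_det_boxAd_eq_one_of_mem_unipotentRadicalGL`). [cite: BernsteinZelevinsky1977, §1.9] -/
theorem exists_homeomorph_conj_map_eq_of_mem_unipotentRadicalGL (hc' : Monotone c') {f : α → Bool}
    (hf : Monotone f) (hcf : c = f ∘ c')
    [MeasurableSpace ↥(unipotentRadicalGL F c)] [BorelSpace ↥(unipotentRadicalGL F c)]
    (ν : Measure ↥(unipotentRadicalGL F c)) [IsHaarMeasure ν] (p : standardParabolicGL F c)
    (hp : (p : GL (Fin n) F) ∈ unipotentRadicalGL F c') :
    ∃ T : ↥(unipotentRadicalGL F c) ≃ₜ ↥(unipotentRadicalGL F c),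
      (∀ u : ↥(unipotentRadicalGL F c),
        (T u : GL (Fin n) F) = (p : GL (Fin n) F) * (u : GL (Fin n) F) * (p : GL (Fin n) F)⁻¹) ∧
      Measure.map T ν = ν := by
  obtain ⟨T, hT, -, hTν⟩ := exists_homeomorph_unipotentRadicalGL_parabolic_conj ν p
  refine ⟨T, hT, ?_⟩
  rw [hTν, map_inv₀, normAbs_det_boxAd_eq_one_of_mem_unipotentRadicalGL hc' hf hcf p hp, inv_one,
    ENNReal.coe_one, one_smul]

/-- **`∫⁻_{U_c} G(p u p⁻¹) dμ_U = ∫⁻_{U_c} G(u) dμ_U`** for every `G : GL_n(F) → [0, ∞]`, every Haar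
measure `μ_U` on `U_c(F)` and every `p ∈ P_c(F)` lying in a finer unipotent radical `U_{c'}(F)`
(transport along the measure-preserving homeomorphism `u ↦ p u p⁻¹`; no measurability needed).
[cite: BernsteinZelevinsky1977, §1.9] -/
theorem lintegral_conj_eq_of_mem_unipotentRadicalGL (hc' : Monotone c') {f : α → Bool}
    (hf : Monotone f) (hcf : c = f ∘ c')
    [MeasurableSpace ↥(unipotentRadicalGL F c)] [BorelSpace ↥(unipotentRadicalGL F c)]
    (ν : Measure ↥(unipotentRadicalGL F c)) [IsHaarMeasure ν] (p : standardParabolicGL F c)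
    (hp : (p : GL (Fin n) F) ∈ unipotentRadicalGL F c') (G : GL (Fin n) F → ℝ≥0∞) :
    ∫⁻ u, G ((p : GL (Fin n) F) * (u : GL (Fin n) F) * (p : GL (Fin n) F)⁻¹) ∂ν =
      ∫⁻ u, G (u : GL (Fin n) F) ∂ν := by
  obtain ⟨T, hT, hTν⟩ := exists_homeomorph_conj_map_eq_of_mem_unipotentRadicalGL hc' hf hcf ν p hp
  have key := lintegral_map_equiv (fun u : ↥(unipotentRadicalGL F c) => G (u : GL (Fin n) F))
    T.toMeasurableEquiv (μ := ν)
  rw [Homeomorph.toMeasurableEquiv_coe, hTν] at key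
  calc ∫⁻ u, G ((p : GL (Fin n) F) * (u : GL (Fin n) F) * (p : GL (Fin n) F)⁻¹) ∂ν
      = ∫⁻ u, G ((T u : ↥(unipotentRadicalGL F c)) : GL (Fin n) F) ∂ν :=
        lintegral_congr fun u => by rw [hT u]
    _ = ∫⁻ u, G (u : GL (Fin n) F) ∂ν := by rw [key]

end UnipotentModule

end Literature.NumberTheory.Automorphic
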